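import Summits.AtomisticToContinuum.BoseEinsteinCondensation.Theorems.PeriodicIRBound.Negative.FreeGas

/-!
# Negative lemmas for crux `PeriodicIRBound` (stmt-AtomisticToContinuum-3972), VII: the free-gas slack threshold is sharp and the bound is attained

Supports (does not close) stmt-AtomisticToContinuum-3972, route `BECGroundStateSOS`. Landed copy of
§16 of `Cruxes/PeriodicIRBound/Disproof.lean` (cycle 2, gen-2 disprover seat); all `sorry`-free,
axioms `propext`/`Classical.choice`/`Quot.sound`.

* §16 `free_exists_nearMin_occupation_eq`, `free_bound_attained`, `free_slack_sharp`,
  `free_slack_sharp_eventually` — TIGHTNESS at `v = 0`: the slack `δ_N = 4π²C√ρ/L_N` with which the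
  free gas satisfies the crux (`free_irIneq`, file `FreeGas`) is EXACTLY maximal: at it the bound
  `C√ρ L_N` is ATTAINED at `k = e₁` by a near-minimiser (equality case: the constant cannot be
  lowered at this slack), and `(1+ε)δ_N` already admits a violating near-minimiser. The crux's `∃ δ`
  therefore lives at the scale `√ρ/L_N` (one Bogoliubov phonon at `|k| = 1`), neither at the kinetic
  gap `4π²/L_N²` nor `N`-uniformly (`periodicIRBound_false_uniformSlack`, file `LoadBearing`).
-/

noncomputable section

open MeasureTheory Filter
open scoped ENNReal NNReal ComplexConjugate BigOperators
namespace Summit.AtomisticToContinuum.BoseEinsteinCondensation.Theorems.PeriodicIRBound.Negative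

open Literature.MathematicalPhysics.QuantumManyBody.BoseGas
open Summit.AtomisticToContinuum.BoseEinsteinCondensation.Theses.BECGroundStateSOS
open Summit.AtomisticToContinuum.BoseEinsteinCondensation.Theorems.GaussianDominationCan.Negative
  (symState symFun oneBody periodicEnergy_symState nsq nsq_nonneg e0 e0_ne_zero norm_e0
    nsq_e0 one_le_norm_intVec isRepulsiveFiniteRange_zero)
open Summit.AtomisticToContinuum.BoseEinsteinCondensation.Theorems.CorrectorClosure.Negative
  (hardCore isRepulsiveFiniteRange_hardCore periodicEnergy_hardCore_eq_top
    periodicGroundStateEnergy_one_eq_top)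

variable {L : ℝ} {m : ℕ} {n : Fin 3 → ℤ} {a b : ℝ}

/-! ## §16 TIGHTNESS for the free gas: the admissible slack is EXACTLY `δ_N = 4π²C√ρ/L_N` -/

/-- For the free gas on `L_N`, every occupation `0 ≤ n ≤ N` of `e₁` is realised by a
near-minimiser of slack exactly `4π² n / L_N²` (the two-mode state `Ψ_{n/N}`). [folklore] -/
theorem free_exists_nearMin_occupation_eq {ρ : ℝ} (hρ : 0 < ρ) {N : ℕ} (hN : 0 < N) {n : ℝ}
    (hn0 : 0 ≤ n) (hnN : n ≤ N) :
    ∃ Ψ : PeriodicTrialState N (sideLength ρ N),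
      NearMin 0 ρ N (ENNReal.ofReal (4 * Real.pi ^ 2 * n / sideLength ρ N ^ 2)) Ψ ∧
      cellOccupation N (sideLength ρ N) (planeWaveMode (sideLength ρ N) e0) Ψ.ψ =
        ENNReal.ofReal n := by
  obtain ⟨m, rfl⟩ : ∃ m, N = m + 1 := ⟨N - 1, by omega⟩
  have hL := sideLength_pos_of_pos hρ hN
  have hNR : (0 : ℝ) < ((m + 1 : ℕ) : ℝ) := by positivity
  set t : ℝ := n / ((m + 1 : ℕ) : ℝ) with ht
  have ht0 : 0 ≤ t := div_nonneg hn0 hNR.le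
  have ht1 : t ≤ 1 := by rwa [ht, div_le_one hNR]
  have hNt : ((m + 1 : ℕ) : ℝ) * t = n := by rw [ht]; field_simp
  refine ⟨twoMode m hL e0_ne_zero t ht0 ht1, ?_, ?_⟩
  · unfold NearMin
    rw [periodicGroundStateEnergy_zero_eq_zero _ hL, zero_add,
      periodicEnergy_zero_twoMode hL e0_ne_zero ht0 ht1, nsq_e0]
    refine le_of_eq ?_
    congr 1
    rw [← mul_assoc, hNt]
    field_simp
  · rw [cellOccupation_twoMode hL e0_ne_zero ht0 ht1, hNt]

/-- **The bound is ATTAINED at the threshold slack (free gas).** With `δ_N = 4π²C√ρ/L_N` — the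
slack for which the free gas satisfies the crux with constant `C` (`free_irIneq`) — there is,
eventually in `N`, a `δ_N`-near-minimiser with `n_{e₁} = C√ρ L_N` EXACTLY. So at this slack the
inequality `n_k ≤ C√ρL_N/‖k‖_∞` is an equality case and the constant cannot be lowered.
[folklore] -/
theorem free_bound_attained {ρ C : ℝ} (hρ : 0 < ρ) (hC : 0 ≤ C) :
    ∀ᶠ N : ℕ in atTop, ∃ Ψ : PeriodicTrialState N (sideLength ρ N),
      NearMin 0 ρ N (ENNReal.ofReal (4 * Real.pi ^ 2 * C * Real.sqrt ρ / sideLength ρ N)) Ψ ∧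
      cellOccupation N (sideLength ρ N) (planeWaveMode (sideLength ρ N) e0) Ψ.ψ =
        ENNReal.ofReal (C * Real.sqrt ρ * sideLength ρ N) := by
  filter_upwards [eventually_bound_lt_N hρ C, eventually_gt_atTop 0] with N hlt hN
  have hL := sideLength_pos_of_pos hρ hN
  obtain ⟨Ψ, hΨ, hocc⟩ := free_exists_nearMin_occupation_eq hρ hN
    (mul_nonneg (mul_nonneg hC (Real.sqrt_nonneg ρ)) hL.le) hlt.le
  refine ⟨Ψ, ?_, hocc⟩
  have heq : 4 * Real.pi ^ 2 * (C * Real.sqrt ρ * sideLength ρ N) / sideLength ρ N ^ 2 =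
      4 * Real.pi ^ 2 * C * Real.sqrt ρ / sideLength ρ N := by
    field_simp
  rwa [heq] at hΨ

/-- **The threshold is SHARP (free gas).** Any slack `δ ≥ 4π² n/L_N²` with
`C√ρ L_N < n ≤ N` admits a `δ`-near-minimiser VIOLATING the bound at `k = e₁` (`n_{e₁} = n`).
Hence, for the free gas and constant `C`, the admissible slacks are exactly
`δ_N ≤ 4π²C√ρ/L_N` (while `C√ρL_N < N`): the `∃ δ` of the crux must be chosen at the scale
`√ρ/L_N` — one Bogoliubov phonon `≈ 8π√(πaρ)/L_N` at `|k| = 1` for the interacting gas — and not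
at the scale of the kinetic gap `4π²/L_N²` alone nor `N`-uniformly (`periodicIRBound_false_uniformSlack`).
[folklore] -/
theorem free_slack_sharp {ρ C : ℝ} (hρ : 0 < ρ) (hC : 0 ≤ C) {N : ℕ} (hN : 0 < N) {n : ℝ}
    (hCn : C * Real.sqrt ρ * sideLength ρ N < n) (hnN : n ≤ N) {δ : ℝ≥0∞}
    (hδ : ENNReal.ofReal (4 * Real.pi ^ 2 * n / sideLength ρ N ^ 2) ≤ δ) :
    ∃ Ψ : PeriodicTrialState N (sideLength ρ N), NearMin 0 ρ N δ Ψ ∧ ¬ IRIneq C ρ N Ψ.ψ e0 := by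
  have hB : 0 ≤ C * Real.sqrt ρ * sideLength ρ N :=
    mul_nonneg (mul_nonneg hC (Real.sqrt_nonneg ρ)) (sideLength_nonneg hρ.le N)
  obtain ⟨Ψ, hΨ, hocc⟩ := free_exists_nearMin_occupation_eq hρ hN (hB.trans hCn.le) hnN
  refine ⟨Ψ, hΨ.trans (add_le_add le_rfl hδ), fun hir => ?_⟩
  rw [irIneq_iff, hocc, norm_e0, div_one] at hir
  have := (ENNReal.ofReal_le_ofReal_iff hB).1 hir
  linarith

/-- The sharpness in eventual form: for every `ε > 0`, the slack `(1+ε)·4π²C√ρ/L_N` is already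
too large for the free gas at constant `C` (witness `n_{e₁} = (1+ε) C√ρ L_N`). [folklore] -/
theorem free_slack_sharp_eventually {ρ C ε : ℝ} (hρ : 0 < ρ) (hC : 0 < C) (hε : 0 < ε) :
    ∀ᶠ N : ℕ in atTop, ∃ Ψ : PeriodicTrialState N (sideLength ρ N),
      NearMin 0 ρ N (ENNReal.ofReal ((1 + ε) * (4 * Real.pi ^ 2 * C * Real.sqrt ρ / sideLength ρ N))) Ψ ∧
      ¬ IRIneq C ρ N Ψ.ψ e0 := by
  filter_upwards [eventually_bound_lt_N hρ ((1 + ε) * C), eventually_gt_atTop 0] with N hlt hN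
  have hL := sideLength_pos_of_pos hρ hN
  have hB : 0 < C * Real.sqrt ρ * sideLength ρ N := by positivity
  refine free_slack_sharp hρ hC.le hN (n := (1 + ε) * C * Real.sqrt ρ * sideLength ρ N)
    (by nlinarith) hlt.le (le_of_eq ?_)
  congr 1
  field_simp

end Summit.AtomisticToContinuum.BoseEinsteinCondensation.Theorems.PeriodicIRBound.Negative

end
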